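import Mathlib
import Summits.ValiantsHypothesis.ValiantsHypothesis.Theorems.GrenetZeonDualUnipotentThreeHalvesRadicalCoarseningTrace
import Summits.ValiantsHypothesis.ValiantsHypothesis.Theorems.GrenetZeonDualUnipotentThreeHalvesRadicalCoarseningLoewyFlag
import Summits.ValiantsHypothesis.ValiantsHypothesis.Theorems.GrenetZeonTwoDimCoefficientsDualUnipotentTriangular

/-!
# `GrenetZeon.DualUnipotentThreeHalves` (stmt-ValiantsHypothesis-24318) — line `radical_split`, stub R1: BRICK 2c,
# the FINE LOEWY FLAG in coordinates: a one-parameter pencil whose constant part lies in a matrix algebra `𝒜` and whose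
# linear part lies in an ideal `J` with `J ^ L = ⊥` is `FlagAdapted` (drop `0`, climb `1`) to a flag with `L` levels

HONEST FRAMING.  Helper file (`--supports stmt-ValiantsHypothesis-24318 --as helper`; val-lit port pool, seat
val-port-3 g0; desk g12 RULING #271 (a′) / #272 (d); line owner val-idea-9 g3 l.7792).  Third brick toward R1
`stub_radicalCoarsening`; with BRICK 1 (`…RadicalCoarseningTrace`: `RadOrth` ⇒ linear parts in the Jacobson radical,
which is nilpotent) it yields the FINE-FLAG case of R1 («`FlagCheap` whenever `L·n < finrank K`», NO coarsening).  The
statement `flagAdaptedUpTo_of_coeffs` is the UNFOLDED text of the line's `FlagAdaptedUpTo m (L-1) n M`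
(`Cruxes/DualUnipotentThreeHalves/Lines/radical_split.lean` §1; defs are not importable from `Cruxes/`).  Nothing here
proves R1 with its registered constant (that needs BRICK 3, the greedy coarsening), nothing bears on the rung
`…Theses.GrenetZeon.DualUnipotentThreeHalves`, on 24318 / 8062, or on `VP ≠ VNP` (NOT proved).  No definitions, no
named facts.
[folklore] change of basis adapted to a flag; coefficient bookkeeping.
-/

-- `Summit.ValiantsHypothesis.ValiantsHypothesis.…` is the tree's mandated single-conjunct layout (Sub = Summit).
set_option linter.dupNamespace false

noncomputable section

namespace Summit.ValiantsHypothesis.ValiantsHypothesis.Theorems.GrenetZeon.RadicalCoarsening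

open Matrix MvPolynomial
open scoped BigOperators

section Coordinates

variable {m : ℕ}

/-- Coefficient extraction commutes with conjugation by CONSTANT matrices:
`coeff d (X·M·Y)ᵢⱼ = (X · M.map (coeff d) · Y)ᵢⱼ`. [folklore] -/
theorem coeff_conj_apply {σ : Type*} (X Y : Matrix (Fin m) (Fin m) ℂ)
    (M : Matrix (Fin m) (Fin m) (MvPolynomial σ ℂ)) (d : σ →₀ ℕ) (i j : Fin m) :
    coeff d ((X.map (C : ℂ →+* MvPolynomial σ ℂ) * M * Y.map (C : ℂ →+* MvPolynomial σ ℂ) :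
        Matrix (Fin m) (Fin m) (MvPolynomial σ ℂ)) i j) = (X * M.map (coeff d) * Y) i j := by
  simp only [Matrix.mul_apply, Matrix.map_apply]
  rw [coeff_sum]
  refine Finset.sum_congr rfl fun l _ => ?_
  rw [Finset.sum_mul, Finset.sum_mul, coeff_sum]
  refine Finset.sum_congr rfl fun k _ => ?_
  rw [mul_comm, ← mul_assoc, ← C_mul, coeff_C_mul]
  ring

/-- In a basis `b` of `ℂ^m`, the conjugate `Q · A · P` of a matrix `A` by the coordinate isomorphism
(`Q = [b.equivFun]`, `P = [b.equivFun⁻¹]`) has `(i, j)` entry the `i`-th `b`-coordinate of `A · b j`. [folklore] -/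
theorem conj_entry_eq_repr (b : Module.Basis (Fin m) ℂ (Fin m → ℂ)) (A : Matrix (Fin m) (Fin m) ℂ) (i j : Fin m) :
    (LinearMap.toMatrix' (b.equivFun : (Fin m → ℂ) →ₗ[ℂ] (Fin m → ℂ)) * A *
        LinearMap.toMatrix' (b.equivFun.symm : (Fin m → ℂ) →ₗ[ℂ] (Fin m → ℂ))) i j =
      b.repr (A.mulVec (b j)) i := by
  have hA : A = LinearMap.toMatrix' (Matrix.toLin' A) := (LinearMap.toMatrix'_toLin' A).symm
  conv_lhs => rw [hA]
  rw [← LinearMap.toMatrix'_comp, ← LinearMap.toMatrix'_comp, LinearMap.toMatrix'_apply]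
  have h1 : b.equivFun (b j) = Pi.single j 1 := by
    rw [Module.Basis.equivFun_apply, Module.Basis.repr_self, Finsupp.single_eq_pi_single]
  have hsymm : b.equivFun.symm (Pi.single j 1) = b j := by
    rw [← h1, LinearEquiv.symm_apply_apply]
  simp only [LinearMap.coe_comp, Function.comp_apply, LinearEquiv.coe_coe]
  rw [hsymm, Matrix.toLin'_apply, Module.Basis.equivFun_apply]

/-- The coordinate matrices of a basis are mutually inverse. [folklore] -/
theorem toMatrix'_equivFun_mul_symm (b : Module.Basis (Fin m) ℂ (Fin m → ℂ)) :
    LinearMap.toMatrix' (b.equivFun : (Fin m → ℂ) →ₗ[ℂ] (Fin m → ℂ)) *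
        LinearMap.toMatrix' (b.equivFun.symm : (Fin m → ℂ) →ₗ[ℂ] (Fin m → ℂ)) = 1 := by
  rw [← LinearMap.toMatrix'_comp]
  have : (b.equivFun : (Fin m → ℂ) →ₗ[ℂ] (Fin m → ℂ)) ∘ₗ (b.equivFun.symm : (Fin m → ℂ) →ₗ[ℂ] (Fin m → ℂ)) =
      LinearMap.id := by
    apply LinearMap.ext; intro x; simp
  rw [this, LinearMap.toMatrix'_id]

/-- The coordinate matrices of a basis are mutually inverse (other order). [folklore] -/
theorem toMatrix'_symm_mul_equivFun (b : Module.Basis (Fin m) ℂ (Fin m → ℂ)) :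
    LinearMap.toMatrix' (b.equivFun.symm : (Fin m → ℂ) →ₗ[ℂ] (Fin m → ℂ)) *
        LinearMap.toMatrix' (b.equivFun : (Fin m → ℂ) →ₗ[ℂ] (Fin m → ℂ)) = 1 := by
  rw [← LinearMap.toMatrix'_comp]
  have : (b.equivFun.symm : (Fin m → ℂ) →ₗ[ℂ] (Fin m → ℂ)) ∘ₗ (b.equivFun : (Fin m → ℂ) →ₗ[ℂ] (Fin m → ℂ)) =
      LinearMap.id := by
    apply LinearMap.ext; intro x; simp
  rw [this, LinearMap.toMatrix'_id]

end Coordinates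

section FineFlag

variable {m : ℕ}

/-- **The fine Loewy flag in coordinates** (the unfolded `FlagAdaptedUpTo m (L-1) n M` of the line `radical_split`).
Let `𝒜 ⊆ M_m(ℂ)` be a subalgebra and `J` an ideal of `↥𝒜` with `J ^ L = ⊥`.  Let `M` be an `m × m` matrix of
polynomials in ONE variable `s` whose constant part `M₀` lies in `𝒜`, whose `s`-part `M₁` lies in `J`, and with no
higher powers of `s`.  Then, in a basis adapted to the Loewy flag `ℂ^m ⊇ J·ℂ^m ⊇ ⋯ ⊇ J^L·ℂ^m = 0` (levels `lvl`,
`p = L`, drop `r = 0`, weight `a = 0`, budget `(p − 1 + r(n−1))/(a+1) = L − 1`): a non-zero `s^e`-coefficient at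
`(i, j)` of the conjugated matrix forces `e + lvl j ≤ lvl i` (the constant part preserves the flag, the `s`-part climbs).
[folklore; the line's card §2, fine-flag case] -/
theorem flagAdaptedUpTo_of_coeffs (𝒜 : Subalgebra ℂ (Matrix (Fin m) (Fin m) ℂ)) (J : Ideal 𝒜) {L : ℕ}
    (hL : J ^ L = ⊥) (M : Matrix (Fin m) (Fin m) (MvPolynomial (Fin 1) ℂ))
    (h0 : M.map (coeff 0) ∈ 𝒜)
    (h1 : ∃ h : M.map (coeff (Finsupp.single 0 1)) ∈ 𝒜, (⟨M.map (coeff (Finsupp.single 0 1)), h⟩ : 𝒜) ∈ J)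
    (h2 : ∀ d : Fin 1 →₀ ℕ, 2 ≤ d 0 → ∀ i j, coeff d (M i j) = 0) (n : ℕ) :
    ∃ (g : (Matrix (Fin m) (Fin m) ℂ)ˣ) (lvl : Fin m → ℕ) (p r a : ℕ),
      (∀ i, lvl i < p) ∧ (p - 1 + r * (n - 1)) / (a + 1) ≤ L - 1 ∧
      ∀ (i j : Fin m) (d : Fin 1 →₀ ℕ),
        coeff d (((g : Matrix (Fin m) (Fin m) ℂ).map C * M * (↑g⁻¹ : Matrix (Fin m) (Fin m) ℂ).map C :
            Matrix (Fin m) (Fin m) (MvPolynomial (Fin 1) ℂ)) i j) ≠ 0 →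
          (a + 1) * d 0 + lvl j ≤ lvl i + r := by
  classical
  obtain ⟨F, hanti, hF0, hFL, hstab, hclimb⟩ := exists_loewy_flag 𝒜 J hL
  obtain ⟨B, lvl, hli, hsp, hmemF, hlvlL, hspan⟩ := exists_adapted_set F hanti hF0 L hFL
  -- a basis indexed by `B`, then by `Fin m`
  have hli' : LinearIndependent ℂ (fun u : B => (u : Fin m → ℂ)) := hli.linearIndependent
  have hsp' : ⊤ ≤ Submodule.span ℂ (Set.range fun u : B => (u : Fin m → ℂ)) := by
    rw [Subtype.range_coe, hsp]
  let bB : Module.Basis B ℂ (Fin m → ℂ) := Module.Basis.mk hli' hsp'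
  haveI : Fintype B := hli'.setFinite.fintype
  have hcard : Fintype.card B = m := by
    have h := Module.finrank_eq_card_basis bB
    rw [Module.finrank_fin_fun] at h
    exact h.symm
  let e : B ≃ Fin m := Fintype.equivFinOfCardEq hcard
  let b : Module.Basis (Fin m) ℂ (Fin m → ℂ) := bB.reindex e
  have hb : ∀ i, b i = ((e.symm i : B) : Fin m → ℂ) := fun i => by
    show (bB.reindex e) i = _
    rw [Module.Basis.reindex_apply, Module.Basis.mk_apply]
  have hbmem : ∀ i, b i ∈ B := fun i => by rw [hb]; exact (e.symm i).2
  -- coordinates supported on high levels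
  have key : ∀ (t : ℕ) (w : Fin m → ℂ), w ∈ F t → ∀ i, b.repr w i ≠ 0 → t ≤ lvl (b i) := by
    intro t w hw i hi
    have hw' : w ∈ Submodule.span ℂ (b '' {i | t ≤ lvl (b i)}) := by
      refine Submodule.span_mono ?_ (hspan t hw)
      rintro u ⟨huB, hut⟩
      refine ⟨e ⟨u, huB⟩, ?_, ?_⟩
      · show t ≤ lvl (b (e ⟨u, huB⟩))
        rw [hb, Equiv.symm_apply_apply]
        exact hut
      · rw [hb, Equiv.symm_apply_apply]
    have hsub := b.repr_support_subset_of_mem_span _ hw'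
    exact hsub (Finsupp.mem_support_iff.2 hi)
  -- the change of basis
  let Q : Matrix (Fin m) (Fin m) ℂ := LinearMap.toMatrix' (b.equivFun : (Fin m → ℂ) →ₗ[ℂ] (Fin m → ℂ))
  let P : Matrix (Fin m) (Fin m) ℂ := LinearMap.toMatrix' (b.equivFun.symm : (Fin m → ℂ) →ₗ[ℂ] (Fin m → ℂ))
  let g : (Matrix (Fin m) (Fin m) ℂ)ˣ :=
    ⟨Q, P, toMatrix'_equivFun_mul_symm b, toMatrix'_symm_mul_equivFun b⟩
  refine ⟨g, fun i => lvl (b i), L, 0, 0, ?_, ?_, ?_⟩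
  · -- levels are `< L`: a basis vector of level `L` would lie in `F L = ⊥`
    intro i
    rcases (hlvlL (b i) (hbmem i)).lt_or_eq with hlt | heq
    · exact hlt
    · exfalso
      have hmem := hmemF (b i) (hbmem i)
      rw [heq, hFL, Submodule.mem_bot] at hmem
      exact b.ne_zero i hmem
  · simp
  · intro i j d hd
    show (0 + 1) * d 0 + lvl (b j) ≤ lvl (b i) + 0
    have hg : ((g : (Matrix (Fin m) (Fin m) ℂ)ˣ) : Matrix (Fin m) (Fin m) ℂ) = Q := rfl
    have hg' : ((g⁻¹ : (Matrix (Fin m) (Fin m) ℂ)ˣ) : Matrix (Fin m) (Fin m) ℂ) = P := rfl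
    rw [hg, hg', coeff_conj_apply] at hd
    have hdd : d = Finsupp.single 0 (d 0) := by
      refine Finsupp.ext fun t => ?_
      have ht : t = 0 := Subsingleton.elim t 0
      subst ht
      rw [Finsupp.single_eq_same]
    rcases Nat.lt_or_ge (d 0) 2 with hlt | hge
    · rcases (show d 0 = 0 ∨ d 0 = 1 by omega) with h | h
      · -- constant part: `M₀ ∈ 𝒜` preserves the flag
        have hd0 : d = 0 := by rw [hdd, h, Finsupp.single_zero]
        rw [hd0, conj_entry_eq_repr] at hd
        have hw : (M.map (coeff 0)).mulVec (b j) ∈ F (lvl (b j)) := hstab _ _ h0 _ (hmemF _ (hbmem j))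
        have hle := key _ _ hw i hd
        rw [h]
        omega
      · -- `s`-part: `M₁ ∈ J` climbs
        have hd1 : d = Finsupp.single 0 1 := by rw [hdd, h]
        rw [hd1, conj_entry_eq_repr] at hd
        obtain ⟨hmemA, hJ⟩ := h1
        have hw : (M.map (coeff (Finsupp.single 0 1))).mulVec (b j) ∈ F (lvl (b j) + 1) :=
          hclimb _ ⟨_, hmemA⟩ hJ _ (hmemF _ (hbmem j))
        have hle := key _ _ hw i hd
        rw [h]
        omega
    · -- no higher powers of `s`
      exfalso
      apply hd
      have hz : M.map (coeff d) = 0 := by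
        ext k l
        rw [Matrix.map_apply, Matrix.zero_apply]
        exact h2 d hge k l
      rw [hz, Matrix.mul_zero, Matrix.zero_mul, Matrix.zero_apply]

end FineFlag

section Pencil

open Summit.ValiantsHypothesis.ValiantsHypothesis.Cruxes.TwoDimCoefficients.DimTwoCases
  (AffMat IsAffine aeval_line_of_totalDegree_le_one constantCoeff_aeval_line)

variable {n m : ℕ}

/-- For an affine polynomial `g`, `g(v) − g(0) = Σ_c v_c · [x_c] g` (the linear part evaluated at `v`). [folklore] -/
theorem eval_sub_eval_zero_of_totalDegree_le_one (g : MvPolynomial (Fin n × Fin n) ℂ) (hg : g.totalDegree ≤ 1)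
    (v : Fin n × Fin n → ℂ) :
    MvPolynomial.eval v g - MvPolynomial.eval 0 g = ∑ c, v c * coeff (Finsupp.single c 1) g := by
  have hg' := Literature.Computability.AlgebraicComplexity.LRPencil.eq_affine_of_totalDegree_le_one g hg
  have heval : ∀ y : Fin n × Fin n → ℂ,
      MvPolynomial.eval y g = coeff 0 g + ∑ w, coeff (Finsupp.single w 1) g * y w := by
    intro y
    conv_lhs => rw [hg']
    simp [MvPolynomial.eval_X]
  rw [heval v, heval 0]
  simp only [Pi.zero_apply, mul_zero, Finset.sum_const_zero, add_zero, add_sub_cancel_left]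
  exact Finset.sum_congr rfl fun c _ => mul_comm _ _

/-- The pulled-back pencil `N(x + s·v)` (the line's `N.map (lineSubst x v)`, unfolded): its constant part is `N(x)`,
its `s`-part is the linear part `N(v) − N(0)`, and it has no higher powers of `s` (entries affine). [folklore] -/
theorem coeff_map_lineSubst (N : AffMat n m) (hN : IsAffine N) (x v : Fin n × Fin n → ℂ) :
    (N.map (MvPolynomial.aeval fun c =>
        (C (x c) + ∑ t : Fin 1, C (v c) * X t : MvPolynomial (Fin 1) ℂ))).map (coeff 0) =
        N.map (MvPolynomial.eval x) ∧
    (N.map (MvPolynomial.aeval fun c =>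
        (C (x c) + ∑ t : Fin 1, C (v c) * X t : MvPolynomial (Fin 1) ℂ))).map (coeff (Finsupp.single 0 1)) =
        N.map (MvPolynomial.eval v) - N.map (MvPolynomial.eval 0) ∧
    (∀ d : Fin 1 →₀ ℕ, 2 ≤ d 0 → ∀ i j,
      coeff d ((N.map (MvPolynomial.aeval fun c =>
        (C (x c) + ∑ t : Fin 1, C (v c) * X t : MvPolynomial (Fin 1) ℂ))) i j) = 0) := by
  -- the line map is `aeval_line` with the one-member family `fun _ => v`
  have hform : ∀ i j, (MvPolynomial.aeval fun c =>
      (C (x c) + ∑ t : Fin 1, C (v c) * X t : MvPolynomial (Fin 1) ℂ)) (N i j) =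
      C (MvPolynomial.eval x (N i j)) +
        ∑ t : Fin 1, C (∑ c, (fun _ : Fin 1 => v) t c * coeff (Finsupp.single c 1) (N i j)) * X t :=
    fun i j => aeval_line_of_totalDegree_le_one x (fun _ : Fin 1 => v) (hN i j)
  have hlin : ∀ i j, ∑ c, (fun _ : Fin 1 => v) (0 : Fin 1) c * coeff (Finsupp.single c 1) (N i j) =
      MvPolynomial.eval v (N i j) - MvPolynomial.eval 0 (N i j) := by
    intro i j
    rw [eval_sub_eval_zero_of_totalDegree_le_one (N i j) (hN i j) v]
  have h10 : (Finsupp.single (0 : Fin 1) 1 : Fin 1 →₀ ℕ) ≠ 0 := by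
    intro h
    have := congrArg (fun f => f 0) h
    simp at this
  refine ⟨?_, ?_, ?_⟩
  · ext i j
    simp only [Matrix.map_apply]
    rw [hform i j]
    simp only [Fin.sum_univ_one, C_mul_X_eq_monomial, coeff_add, coeff_C, if_true, coeff_monomial,
      if_neg h10, add_zero]
  · ext i j
    simp only [Matrix.map_apply, Matrix.sub_apply]
    rw [hform i j, ← hlin i j]
    simp only [Fin.sum_univ_one, C_mul_X_eq_monomial, coeff_add, coeff_C, if_neg h10.symm, coeff_monomial,
      if_true, zero_add]
  · intro d hd i j
    simp only [Matrix.map_apply]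
    rw [hform i j]
    have hd0 : ¬ ((0 : Fin 1 →₀ ℕ) = d) := by
      intro h; rw [← h] at hd; simp at hd
    have hd1 : ¬ (Finsupp.single (0 : Fin 1) 1 = d) := by
      intro h; rw [← h] at hd; simp at hd
    simp only [Fin.sum_univ_one, C_mul_X_eq_monomial, coeff_add, coeff_C, if_neg hd0, coeff_monomial,
      if_neg hd1, add_zero]

/-- **R1, FINE-FLAG CASE (no coarsening).**  Let `N` be an affine `m × m` pencil over the `n × n` variables, `K` a
direction space TRACE-ORTHOGONAL to the pencil algebra `𝒜(N) = Algebra.adjoin ℂ {N(x)}` (the line's `RadOrth`,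
unfolded), and let `L` kill the Jacobson radical of `𝒜(N)` (`(Ideal.jacobson ⊥)^L = ⊥`; BRICK 1 gives such an `L`).
If `L·n < dim K` (and `1 ≤ L`), then `N` is FLAG-CHEAP in the line's sense (`FlagCheap n m N`, unfolded): along every
line `x + s·v`, `v ∈ K`, the pencil is adapted — after a constant change of basis, the SAME for all lines — to the
Loewy flag with budget `L − 1`, and `(L − 1 + 1)·n < dim K`.  The registered R1 (constant `16m⌊√n⌋ + 16n`, no
hypothesis on `L`) needs the greedy coarsening (BRICK 3) on top of this. [the line's card §2; folklore] -/
theorem flagCheap_of_radOrth_of_loewy_length (N : AffMat n m) (hN : IsAffine N)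
    (K : Submodule ℂ (Fin n × Fin n → ℂ))
    (hK : ∀ v ∈ K, ∀ b ∈ Algebra.adjoin ℂ (Set.range fun y : Fin n × Fin n → ℂ => N.map (MvPolynomial.eval y)),
      Matrix.trace ((N.map (MvPolynomial.eval v) - N.map (MvPolynomial.eval 0)) * b) = 0)
    {L : ℕ} (hL1 : 1 ≤ L)
    (hL : (Ideal.jacobson (⊥ : Ideal (Algebra.adjoin ℂ
        (Set.range fun y : Fin n × Fin n → ℂ => N.map (MvPolynomial.eval y))))) ^ L = ⊥)
    (hdim : L * n < Module.finrank ℂ K) :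
    ∃ (K' : Submodule ℂ (Fin n × Fin n → ℂ)) (k : ℕ),
      (∀ x v : Fin n × Fin n → ℂ, v ∈ K' →
        ∃ (g : (Matrix (Fin m) (Fin m) ℂ)ˣ) (lvl : Fin m → ℕ) (p r a : ℕ),
          (∀ i, lvl i < p) ∧ (p - 1 + r * (n - 1)) / (a + 1) ≤ k ∧
          ∀ (i j : Fin m) (d : Fin 1 →₀ ℕ),
            coeff d (((g : Matrix (Fin m) (Fin m) ℂ).map C *
                N.map (MvPolynomial.aeval fun c =>
                  (C (x c) + ∑ t : Fin 1, C (v c) * X t : MvPolynomial (Fin 1) ℂ)) *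
                (↑g⁻¹ : Matrix (Fin m) (Fin m) ℂ).map C : Matrix (Fin m) (Fin m) (MvPolynomial (Fin 1) ℂ)) i j) ≠ 0 →
            (a + 1) * d 0 + lvl j ≤ lvl i + r) ∧
      (k + 1) * n < Module.finrank ℂ K' := by
  refine ⟨K, L - 1, fun x v hv => ?_, by rwa [Nat.sub_add_cancel hL1]⟩
  obtain ⟨h0, h1, h2⟩ := coeff_map_lineSubst N hN x v
  refine flagAdaptedUpTo_of_coeffs _ _ hL _ ?_ ?_ h2 n
  · rw [h0]; exact eval_mem_pencilAdjoin N x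
  · refine ⟨by rw [h1]; exact linPart_mem_pencilAdjoin N v, ?_⟩
    have := linPart_mem_jacobson_of_radOrth N K hK hv
    convert this using 2

end Pencil


end Summit.ValiantsHypothesis.ValiantsHypothesis.Theorems.GrenetZeon.RadicalCoarsening

end
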